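import Literature.NumberTheory.Sieve.RoughOmegaCellsClassesEquidistribution
import HarnessLib

/-!
# Ω-cells of the rough integers in the reduced classes: a constant exponential in the range

Topic `Literature/NumberTheory/Sieve`. Everything here is PROVED. The theorem
`RoughCellsAP.exists_abs_cellClassDisc_le` (`RoughOmegaCellsClassesEquidistribution.lean`) gives, for
each modulus `q ≥ 1` and each range parameter `n`, a constant `C = C(q, n)` with
`|Φ_{j+1}(X, Y; q, c) − Φ_{j+1}(X, Y)/φ(q)| ≤ C X/log² Y` for `2 ≤ Y ≤ X`, `log X ≤ n log Y`, `q < Y`,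
`(c, q) = 1` (`Φ_j(X, Y; q, c) = #{b ∈ roughIcc ⌈Y⌉ ⌊X⌋ : Ω b = j, b ≡ c (q)}`), hidden behind an
existential PER `n`. Its proof is the recursion `C₂ = 2C_π + 4`, `C_{k+1} = C_k (1 + K) + 2C_π + 4`
with the absolute `K = 3(1 + 2C₀) + 2C₀` (`C₀` the de la Vallée Poussin constant of
`|ϑ(t) − t| ≤ C₀ t/log² t`, `C_π = C_π(q)` the constant of the prime number theorem for the
progressions mod `q` in `π`-form, `exists_abs_primeCountingDisc_le`), so that `C(q, n) ≤ A^n` with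
`A = max (2C_π + 4) (2 + K)`. This file re-runs the induction keeping the constant in this shape:

* `RoughCellsAP.exists_abs_cellClassDisc_le_pow` — for every `q ≥ 1` there is `A ≥ 1` such that the
  bound `A^n X/log² Y` holds for ALL `n` simultaneously;
* `RoughCellsAP.exists_abs_cellClassDisc_le_pow_of_le` — the same with one `A` serving every modulus
  `1 ≤ q ≤ Q`.

This is the form needed when the roughness `u = log X/log Y` grows slowly with the scale (e.g.
`u ≍ √(log log X)`, where `A^u = (log X)^{o(1)}`). Nothing else is here: the analytic input is entirely
in `abs_cellClassDisc_base` / `abs_cellClassDisc_step`.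

## References

* G. Tenenbaum, *Introduction to analytic and probabilistic number theory*, 3rd ed., AMS GSM 163
  (2015), Ch. III.6. [Tenenbaum2015]
* K. Alladi, *The distribution of ν(n) in the sieve of Eratosthenes*, Quart. J. Math. Oxford (2) 33
  (1982), 129–148. [Alladi1982]
-/

open Finset Filter
open scoped Chebyshev Topology ArithmeticFunction.Omega

noncomputable section

namespace Literature.NumberTheory.Sieve

namespace RoughCellsAP

/-- **The `Ω`-cells of the rough integers are equidistributed in the reduced classes, with a constant
exponential in the range parameter.** For every `q ≥ 1` there is `A ≥ 1` such that for all `n`, all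
`2 ≤ Y ≤ X` with `log X ≤ n log Y` and `q < Y`, all `j` and all `(c, q) = 1`,
`|Φ_{j+1}(X, Y; q, c) − Φ_{j+1}(X, Y)/φ(q)| ≤ A^n X/log² Y`
(the induction of `exists_abs_cellClassDisc_le` — base `abs_cellClassDisc_base`, step
`abs_cellClassDisc_step` — run with `A = max (2C_π + 4) (2 + K)`, `K = 3(1 + 2C₀) + 2C₀`, which gives
the constant `A^n` in the range `log X ≤ n log Y`, `n ≥ 2`; the range `n ≤ 1` is the base range, and
`n = 0` is void). [folklore] -/
theorem exists_abs_cellClassDisc_le_pow (q : ℕ) (hq : 0 < q) :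
    ∃ A : ℝ, 1 ≤ A ∧ ∀ n : ℕ, ∀ X Y : ℝ, 2 ≤ Y → Y ≤ X → Real.log X ≤ n * Real.log Y →
      (q : ℝ) < Y → ∀ j c : ℕ, c.Coprime q →
        |(#((roughIcc ⌈Y⌉₊ ⌊X⌋₊).filter (fun b => Ω b = j + 1 ∧ b ≡ c [MOD q])) : ℝ) -
            (#((roughIcc ⌈Y⌉₊ ⌊X⌋₊).filter (fun b => Ω b = j + 1)) : ℝ) / Nat.totient q| ≤
          A ^ n * X / Real.log Y ^ 2 := by
  obtain ⟨C₀, hC₀, hE⟩ := Literature.NumberTheory.LFunctions.exists_abs_theta_sub_self_le_div_log_sq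
  obtain ⟨Cπ, hCπ0, hCπ⟩ := exists_abs_primeCountingDisc_le q hq
  set K : ℝ := (1 + 2 * C₀) * 3 + 2 * C₀ with hK
  have hK0 : 0 ≤ K := by positivity
  set A : ℝ := max (2 * Cπ + 4) (2 + K) with hA
  have hAπ : 2 * Cπ + 4 ≤ A := le_max_left _ _
  have hAK : 2 + K ≤ A := le_max_right _ _
  have hA1 : 1 ≤ A := le_trans (by linarith) hAπ
  have hA0 : 0 ≤ A := by linarith
  -- the base range `log X ≤ 2 log Y`, with the constant `A`
  have hbase : ∀ X Y : ℝ, 2 ≤ Y → Y ≤ X → Real.log X ≤ 2 * Real.log Y → ∀ j c : ℕ, c.Coprime q →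
      |(#((roughIcc ⌈Y⌉₊ ⌊X⌋₊).filter (fun b => Ω b = j + 1 ∧ b ≡ c [MOD q])) : ℝ) -
          (#((roughIcc ⌈Y⌉₊ ⌊X⌋₊).filter (fun b => Ω b = j + 1)) : ℝ) / Nat.totient q| ≤
        A * X / Real.log Y ^ 2 := by
    intro X Y hY hYX hXY j c hc
    refine (abs_cellClassDisc_base hq hCπ0 hCπ hY hYX hXY (j + 1) hc).trans ?_
    have hX0 : 0 ≤ X := by linarith
    have hlY : 0 < Real.log Y := Real.log_pos (by linarith)
    rw [div_le_div_iff_of_pos_right (by positivity)]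
    exact mul_le_mul_of_nonneg_right hAπ hX0
  -- the ranges `log X ≤ m log Y`, `m ≥ 2`, with the constant `A^m`
  have hmain : ∀ m : ℕ, 2 ≤ m → ∀ X Y : ℝ, 2 ≤ Y → Y ≤ X →
      Real.log X ≤ m * Real.log Y → (q : ℝ) < Y → ∀ j c : ℕ, c.Coprime q →
        |(#((roughIcc ⌈Y⌉₊ ⌊X⌋₊).filter (fun b => Ω b = j + 1 ∧ b ≡ c [MOD q])) : ℝ) -
            (#((roughIcc ⌈Y⌉₊ ⌊X⌋₊).filter (fun b => Ω b = j + 1)) : ℝ) / Nat.totient q| ≤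
          A ^ m * X / Real.log Y ^ 2 := by
    intro m hm
    induction m, hm using Nat.le_induction with
    | base =>
      intro X Y hY hYX hXY _ j c hc
      refine (hbase X Y hY hYX (by exact_mod_cast hXY) j c hc).trans ?_
      have hX0 : 0 ≤ X := by linarith
      have hlY : 0 < Real.log Y := Real.log_pos (by linarith)
      rw [div_le_div_iff_of_pos_right (by positivity)]
      refine mul_le_mul_of_nonneg_right ?_ hX0
      nlinarith
    | succ k hk ih =>
      intro X Y hY hYX hXY hqY j c hc
      push_cast at hXY
      have hX0 : 0 ≤ X := by linarith
      have hlY : 0 < Real.log Y := Real.log_pos (by linarith)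
      have hAk1 : 1 ≤ A ^ k := one_le_pow₀ hA1
      have hAk0 : 0 ≤ A ^ k := by linarith
      have hAkk : A ^ k ≤ A ^ (k + 1) := by rw [pow_succ]; nlinarith
      have hAk : A ≤ A ^ (k + 1) := by
        rw [pow_succ]; nlinarith
      by_cases h1 : Real.log X ≤ k * Real.log Y
      · refine (ih X Y hY hYX h1 hqY j c hc).trans ?_
        rw [div_le_div_iff_of_pos_right (by positivity)]
        exact mul_le_mul_of_nonneg_right hAkk hX0
      push Not at h1
      rcases lt_or_ge Y (Real.exp 2) with h2 | h2
      · refine (abs_cellClassDisc_le_of_lt_exp_two hq hY hYX h2 (j + 1) c).trans ?_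
        rw [div_le_div_iff_of_pos_right (by positivity)]
        refine mul_le_mul_of_nonneg_right ?_ hX0
        linarith
      rcases j with _ | j
      · -- the cell `Ω = 1`: primes in a progression
        have hP : (roughIcc ⌈Y⌉₊ ⌊X⌋₊).filter (fun b => Ω b = 0 + 1 ∧ b ≡ c [MOD q]) =
            (Icc ⌈Y⌉₊ ⌊X⌋₊).filter (fun p => p.Prime ∧ p ≡ c [MOD q]) := by
          rw [← filter_filter, Nat.zero_add, roughIcc_filter_cardFactors_one, filter_filter]
        rw [hP, Nat.zero_add, roughIcc_filter_cardFactors_one]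
        refine (abs_primes_class_sub_le hCπ0 hCπ hY hYX hc).trans ?_
        rw [div_le_div_iff_of_pos_right (by positivity)]
        refine mul_le_mul_of_nonneg_right ?_ hX0
        linarith
      · -- the cells `Ω = j + 2`: the Buchstab step
        refine (abs_cellClassDisc_step hq hk hAk0 hC₀ hE ih h2 hYX h1 hXY hqY j hc).trans ?_
        rw [div_le_div_iff_of_pos_right (by positivity)]
        refine mul_le_mul_of_nonneg_right ?_ hX0
        rw [← hK, pow_succ]
        nlinarith
  -- all ranges
  refine ⟨A, hA1, fun n X Y hY hYX hXY hqY j c hc => ?_⟩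
  have hX0 : 0 ≤ X := by linarith
  have hlY : 0 < Real.log Y := Real.log_pos (by linarith)
  rcases le_or_gt 2 n with hn | hn
  · exact hmain n hn X Y hY hYX hXY hqY j c hc
  · have hlX : 0 < Real.log X := Real.log_pos (by linarith)
    obtain rfl | rfl : n = 0 ∨ n = 1 := by omega
    · exfalso
      simp only [Nat.cast_zero, zero_mul] at hXY
      linarith
    have hXY2 : Real.log X ≤ 2 * Real.log Y := by
      simp only [Nat.cast_one, one_mul] at hXY
      linarith
    simpa only [pow_one] using hbase X Y hY hYX hXY2 j c hc

/-- **One constant for all bounded moduli.** For every `Q` there is `A ≥ 1` such that for all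
`1 ≤ q ≤ Q`, all `n`, all `2 ≤ Y ≤ X` with `log X ≤ n log Y` and `q < Y`, all `j` and all `(c, q) = 1`,
`|Φ_{j+1}(X, Y; q, c) − Φ_{j+1}(X, Y)/φ(q)| ≤ A^n X/log² Y` (take `A = 1 + ∑_{q ≤ Q} A(q)` with the
constants of `exists_abs_cellClassDisc_le_pow`). [folklore] -/
theorem exists_abs_cellClassDisc_le_pow_of_le (Q : ℕ) :
    ∃ A : ℝ, 1 ≤ A ∧ ∀ q : ℕ, 0 < q → q ≤ Q → ∀ n : ℕ, ∀ X Y : ℝ, 2 ≤ Y → Y ≤ X →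
      Real.log X ≤ n * Real.log Y → (q : ℝ) < Y → ∀ j c : ℕ, c.Coprime q →
        |(#((roughIcc ⌈Y⌉₊ ⌊X⌋₊).filter (fun b => Ω b = j + 1 ∧ b ≡ c [MOD q])) : ℝ) -
            (#((roughIcc ⌈Y⌉₊ ⌊X⌋₊).filter (fun b => Ω b = j + 1)) : ℝ) / Nat.totient q| ≤
          A ^ n * X / Real.log Y ^ 2 := by
  classical
  choose! A hA1 hA using exists_abs_cellClassDisc_le_pow
  have hpos : ∀ q ∈ Finset.Icc 1 Q, 0 ≤ A q := fun q hq => by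
    rw [Finset.mem_Icc] at hq
    linarith [hA1 q hq.1]
  refine ⟨∑ q ∈ Finset.Icc 1 Q, A q + 1, by linarith [Finset.sum_nonneg hpos], ?_⟩
  intro q hq hqQ n X Y hY hYX hXY hqY j c hc
  refine (hA q hq n X Y hY hYX hXY hqY j c hc).trans ?_
  have hX0 : 0 ≤ X := by linarith
  have hlY : 0 < Real.log Y := Real.log_pos (by linarith)
  have hle : A q ≤ ∑ q ∈ Finset.Icc 1 Q, A q + 1 := by
    have h := Finset.single_le_sum hpos (Finset.mem_Icc.mpr ⟨hq, hqQ⟩)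
    linarith
  rw [div_le_div_iff_of_pos_right (by positivity)]
  exact mul_le_mul_of_nonneg_right (pow_le_pow_left₀ (by linarith [hA1 q hq]) hle n) hX0

end RoughCellsAP

end Literature.NumberTheory.Sieve
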